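import Mathlib
import HarnessLib
import Literature.Probability.MarkovChains.LinearAcceptance
import Summits.Ventures.LatticeQCDFlow.Exactness.NoisyAcceptBias
import Summits.Ventures.LatticeQCDFlow.Exactness.OnlineAdaptation

/-!
# LatticeQCDFlow / Exactness — the Kennedy–Kuti linear acceptance WITH a probability-bound
violation is biased: the smallest witness, and its exact no-violation twin

HONEST FRAMING: exact (Metropolis-corrected) sampling algorithms for lattice gauge theory;
figures of merit are autocorrelation/cost numbers at stated couplings and volumes; no
continuum-physics claim.

Venture `LatticeQCDFlow` (cell pub-lqcd), topic `Exactness`; landed by FANOUT row 38 (r2-scope) as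
the Lean face of HOME/R2-SCOPE.md §3 N3 ("Kennedy–Kuti LINEAR acceptance with probability-bound
violations ignored: 'Once the probability bound is violated, detailed balance is lost and systematic
bias will show up' — admissible only with a stated violation count of ZERO over the run (then it is
exact [KK])").  NEW WORK of the cell (elementary finite arithmetic), not a published result; the
published half — exactness at zero violations — is the Literature theorem
`Literature.Probability.MarkovChains.kkKernel_isStationary` (`LinearAcceptance.lean`), which this
file instantiates for the twin.

Data (shared with `NoisyAcceptBias.lean`; `π₂_pos'` from `OnlineAdaptation.lean`): `Fin 2`, target
`π₂ = (1/3, 2/3)`, uniform symmetric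
proposal `T₂ ≡ 1/2`, noise law `g₂ ≡ 1/2` on `Fin 2`, mean-one multiplicative factors
`c₂ = (1/2, 3/2)`; the ratio estimator `ρ₂ x y ξ = (π₂ y / π₂ x) · c₂ ξ` is UNBIASED
(`ρ₂_unbiased`).  Ordering observable `fKK = (1, 0)` (state `0` ranks above state `1`), and
Kennedy–Kuti's own parameters `λ⁺ = 0`, `λ⁻ = 1/2` (Lin–Liu–Sloan 2000 §1: "The choice of
λ⁺ = 0.0, λ⁻ = 1/2 in ref. [KK]").

Results (all proved):
* THE VIOLATION: for the move `0 → 1` the realised acceptance is `ρ/2 ∈ {1/2, 3/2}`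
  (`kkAccept₂_zero_one_*`); the value `3/2 > 1` is an upper-bound violation occurring at HALF of
  the `0 → 1` attempts (`kk₂_violation`); the chain as run clips it to `1`, so the `0 → 1` rate is
  `(1/2)·(3/4) = 3/8` instead of the exact rule's `(1/2)·1 = 1/2` (`kkRate₂_zero_one`,
  `kk₂_exactRate_zero_one`), while `1 → 0` moves at `(1/2)·(1/2) = 1/4` (`kkRate₂_one_zero`);
* THE BIAS: `kk₂_not_stationary : ¬ IsStationary π₂ (kkKernel T₂ 0 (1/2) fKK g₂ ρ₂)` and
  `kk₂_stationary_biased : IsStationary (2/5, 3/5) …` — a relative bias of `1/5` on state `0`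
  (`kk₂_relative_bias`) from an unbiased estimator with healthy-looking acceptances;
* THE EXACT TWIN on the same data: Lin–Liu–Sloan's remedy `λ⁻ = 1/(1+α)` with `α = 3`
  (`λ⁻ = 1/4`) makes every realised value lie in `[0, 1]` (`kk₂α_noViolation`), and then the
  Literature theorem gives `kk₂α_isStationary : IsStationary π₂ (kkKernel T₂ 0 (1/4) fKK g₂ ρ₂)` —
  exact, "albeit at the expense of a lower acceptance rate" (`0 → 1` rate `1/4`,
  `kkRate₂α_zero_one`).

Use: a scorer cannot certify a linear-acceptance row by its estimator being unbiased; it needs the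
run's violation count, and only the count ZERO is certified by a theorem.
-/

namespace Summit.Ventures.LatticeQCDFlow.Exactness

open Finset
open Literature.Probability.MarkovChains

section Witness

/-- Ordering observable of the witness: `fKK = (1, 0)`, state `0` ranks above state `1`.
[folklore] -/
noncomputable def fKK : Fin 2 → ℝ := ![1, 0]

/-- The ratio estimator of the witness: exact ratio times the mean-one noise factor,
`ρ₂ x y ξ = (π₂ y / π₂ x) · c₂ ξ`. [folklore] -/
noncomputable def ρ₂ (x y ξ : Fin 2) : ℝ := π₂ y / π₂ x * c₂ ξ

/-- Value of the ordering observable at state `0`. [folklore] -/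
@[simp] theorem fKK_zero : fKK 0 = 1 := rfl
/-- Value of the ordering observable at state `1`. [folklore] -/
@[simp] theorem fKK_one : fKK 1 = 0 := rfl
/-- Unfolding the estimator. [folklore] -/
@[simp] theorem ρ₂_apply (x y ξ : Fin 2) : ρ₂ x y ξ = π₂ y / π₂ x * c₂ ξ := rfl

/-- The ordering observable separates the two states. [folklore] -/
theorem fKK_injective : Function.Injective fKK := by
  intro a b h
  fin_cases a <;> fin_cases b <;> simp_all

/-- The noise law is a probability vector. [folklore] -/
theorem g₂_sum : ∑ ξ, g₂ ξ = 1 := by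
  rw [Fin.sum_univ_two, g₂_apply, g₂_apply]; norm_num

/-- The estimator is UNBIASED for the ratio `π₂ y / π₂ x` (mean noise factor one). [folklore] -/
theorem ρ₂_unbiased (x y : Fin 2) : ∑ ξ, g₂ ξ * ρ₂ x y ξ = π₂ y / π₂ x := by
  rw [Fin.sum_univ_two]
  simp only [g₂_apply, ρ₂_apply, c₂_zero, c₂_one]
  ring

/-! ### Kennedy–Kuti's parameters `λ⁺ = 0`, `λ⁻ = 1/2`: an upper-bound violation and the bias -/

/-- Realised acceptance of `0 → 1` at the small noise value: `(1/2)·(2·1/2) = 1/2`. [folklore] -/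
theorem kkAccept₂_zero_one_zero : kkAccept 0 (1 / 2) fKK 0 1 (ρ₂ 0 1 0) = 1 / 2 := by
  norm_num [kkAccept]

/-- Realised acceptance of `0 → 1` at the large noise value: `(1/2)·(2·3/2) = 3/2`. [folklore] -/
theorem kkAccept₂_zero_one_one : kkAccept 0 (1 / 2) fKK 0 1 (ρ₂ 0 1 1) = 3 / 2 := by
  norm_num [kkAccept]

/-- **The probability bound IS violated**: a realised "acceptance probability" `3/2 > 1`, at half
of the `0 → 1` attempts. [folklore] -/
theorem kk₂_violation : 1 < kkAccept 0 (1 / 2) fKK 0 1 (ρ₂ 0 1 1) := by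
  rw [kkAccept₂_zero_one_one]; norm_num

/-- Realised acceptance of `1 → 0`: the constant `λ⁻ = 1/2` (no violation there). [folklore] -/
theorem kkAccept₂_one_zero (ξ : Fin 2) : kkAccept 0 (1 / 2) fKK 1 0 (ρ₂ 1 0 ξ) = 1 / 2 := by
  norm_num [kkAccept]

/-- What the rule gives at the EXACT ratio for `0 → 1`: `T₂ 0 1 · (1/2)·2 = 1/2` (acceptance one).
[folklore] -/
theorem kk₂_exactRate_zero_one : T₂ 0 1 * kkAccept 0 (1 / 2) fKK 0 1 (π₂ 1 / π₂ 0) = 1 / 2 := by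
  norm_num [kkAccept]

/-- Rate `0 → 1` of the chain as run: the violating value is clipped to `1`, so
`(1/2)·((1/2)(1/2) + (1/2)·1) = 3/8 < 1/2`. [folklore] -/
theorem kkRate₂_zero_one : kkRate T₂ 0 (1 / 2) fKK g₂ ρ₂ 0 1 = 3 / 8 := by
  rw [kkRate, Fin.sum_univ_two, kkAccept₂_zero_one_zero, kkAccept₂_zero_one_one]
  norm_num [clip01]

/-- Rate `1 → 0` of the chain as run: `(1/2)·(1/2) = 1/4`. [folklore] -/
theorem kkRate₂_one_zero : kkRate T₂ 0 (1 / 2) fKK g₂ ρ₂ 1 0 = 1 / 4 := by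
  rw [kkRate, Fin.sum_univ_two, kkAccept₂_one_zero, kkAccept₂_one_zero]
  norm_num [clip01]

/-- `univ.erase 0 = {1}` in `Fin 2` (private helper). [folklore] -/
private theorem erase_zero₂' : (univ : Finset (Fin 2)).erase 0 = {1} := by decide
/-- `univ.erase 1 = {0}` in `Fin 2` (private helper). [folklore] -/
private theorem erase_one₂' : (univ : Finset (Fin 2)).erase 1 = {0} := by decide

/-- The four entries of the kernel of the chain as run. [folklore] -/
theorem kkKernel₂_entries :
    kkKernel T₂ 0 (1 / 2) fKK g₂ ρ₂ 0 1 = 3 / 8 ∧ kkKernel T₂ 0 (1 / 2) fKK g₂ ρ₂ 1 0 = 1 / 4 ∧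
      kkKernel T₂ 0 (1 / 2) fKK g₂ ρ₂ 0 0 = 5 / 8 ∧ kkKernel T₂ 0 (1 / 2) fKK g₂ ρ₂ 1 1 = 3 / 4 := by
  refine ⟨?_, ?_, ?_, ?_⟩
  · rw [kkKernel_of_ne _ _ _ _ _ _ (by decide), kkRate₂_zero_one]
  · rw [kkKernel_of_ne _ _ _ _ _ _ (by decide), kkRate₂_one_zero]
  · rw [kkKernel_self, erase_zero₂', sum_singleton, kkRate₂_zero_one]; norm_num
  · rw [kkKernel_self, erase_one₂', sum_singleton, kkRate₂_one_zero]; norm_num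

/-- **With a violation the linear algorithm is NOT exact**: `π₂ = (1/3, 2/3)` is not stationary
for the chain as run (flow into state `1`: `(1/3)(3/8) + (2/3)(3/4) = 5/8 ≠ 2/3`), although the
estimator is unbiased — "Once the probability bound is violated, detailed balance is lost and
systematic bias will show up" (Lin–Liu–Sloan 2000 §1), here in the smallest model. [folklore] -/
theorem kk₂_not_stationary : ¬ IsStationary π₂ (kkKernel T₂ 0 (1 / 2) fKK g₂ ρ₂) := by
  intro h
  have h1 := h 1
  obtain ⟨h01, -, -, h11⟩ := kkKernel₂_entries
  rw [Fin.sum_univ_two, h01, h11, π₂_zero, π₂_one] at h1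
  norm_num at h1

/-- The law the chain as run DOES sample: `(2/5, 3/5)` (`(2/5)(3/8) = (3/5)(1/4)`). [folklore] -/
theorem kk₂_stationary_biased :
    IsStationary ![(2 : ℝ) / 5, 3 / 5] (kkKernel T₂ 0 (1 / 2) fKK g₂ ρ₂) := by
  obtain ⟨h01, h10, h00, h11⟩ := kkKernel₂_entries
  intro y
  fin_cases y
  · simp only [Fin.sum_univ_two, Fin.zero_eta, Matrix.cons_val_zero, Matrix.cons_val_one, h00, h10]
    norm_num
  · simp only [Fin.sum_univ_two, Fin.mk_one, Matrix.cons_val_zero, Matrix.cons_val_one, h01, h11]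
    norm_num

/-- Size of the defect: stationary weight `2/5` instead of `1/3` on state `0`, a relative bias of
`1/5`, produced by violations at half of the `0 → 1` attempts. [folklore] -/
theorem kk₂_relative_bias : ((2 : ℝ) / 5 - 1 / 3) / (1 / 3) = 1 / 5 := by norm_num

/-! ### The exact twin: `λ⁻ = 1/(1+α)` with `α = 3` removes the violation -/

/-- With `λ⁻ = 1/4` every realised acceptance value lies in `[0, 1]` (the values are `1/4`, and
`ρ/4 ∈ {1/4, 3/4}` for `0 → 1`): ZERO violations. [folklore] -/
theorem kk₂α_noViolation (x y ξ : Fin 2) :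
    0 ≤ kkAccept 0 (1 / 4) fKK x y (ρ₂ x y ξ) ∧ kkAccept 0 (1 / 4) fKK x y (ρ₂ x y ξ) ≤ 1 := by
  fin_cases x <;> fin_cases y <;> fin_cases ξ <;> norm_num [kkAccept]

/-- **The no-violation twin IS exact** — an instance of the Literature theorem
`kkKernel_isStationary` (Kennedy–Kuti): `π₂` is stationary for the chain as run with `λ⁻ = 1/4`.
[folklore] -/
theorem kk₂α_isStationary : IsStationary π₂ (kkKernel T₂ 0 (1 / 4) fKK g₂ ρ₂) :=
  kkKernel_isStationary π₂_pos' (fun _ _ => rfl) (Or.inr fKK_injective) g₂_sum ρ₂_unbiased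
    kk₂α_noViolation

/-- … "albeit at the expense of a lower acceptance rate": the twin's `0 → 1` rate is
`(1/2)·(1/4)·2 = 1/4` (vs `3/8` biased, `1/2` for the exact rule at `λ⁻ = 1/2`). [folklore] -/
theorem kkRate₂α_zero_one : kkRate T₂ 0 (1 / 4) fKK g₂ ρ₂ 0 1 = 1 / 4 := by
  rw [kkRate_eq_of_noViolation g₂_sum (ρ₂_unbiased 0 1) (kk₂α_noViolation 0 1)]
  norm_num [kkAccept]

end Witness

end Summit.Ventures.LatticeQCDFlow.Exactness
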